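import Mathlib
import HarnessLib
import Summits.ValiantsHypothesis.ValiantsHypothesis.Theorems.LacunarySymmetroidMatrixDescartesProductPlusOneRowTowerKCumulant

/-!
# LINE (A) `product_plus_one` — the PAIR CERTIFICATE of the θ-tower and the PAIR-GAP LAW (every support size, both sides of the root)

Companion of ✓ `…RowTowerKCumulant` (stripped row `A − Σ_l B_l x^{λ_l}`, `u = rowUK`, weights `A·u` at rate `0` and `w_l = (−B_l x^{λ_l})·u` at rate `λ_l`,
total mass `1` where the row does not vanish).  With `φ_p(g) = g²(p² − g²)`:

* §1 `pairDoubleSum_eq` (any finite family of weights and points: `Σ_a Σ_b W_a W_b φ_p(R_a − R_b)` through the moments `Σ_a W_a R_a^k`) and ★ THE PAIR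
  CERTIFICATE `rowPsiK3_pair_certificate` (pure identity, any signs, any real `p`, either side of the root):
  `ψ₃ − p²ψ₁ − 6ψ₁² = ½ Σ_l Σ_{l'} w_l w_{l'} φ_p(λ_l − λ_{l'}) + A u · Σ_l w_l φ_p(λ_l)` («p²κ₂ − κ₄ − 6κ₂² = ½ E φ_p(X − X')»);
* §2 ★ THE PAIR-GAP LAW `rowPsiK3_pairGap_law`: if every two ACTIVE letters with coefficients of the SAME sign are at gap `≤ p` and every two with
  coefficients of OPPOSITE signs are at gap `≥ p` (`x > 0`, row non-vanishing — no side condition: both sides of the root), then `p²ψ₁ + 6ψ₁² ≤ ψ₃`;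
  strict forms `rowPsiK3_gt_of_pairGap` (`ψ₁ ≠ 0`) and `rowPsiK3_gt_of_pairGap_of_pair` (one tail pair, or one bottom–tail pair, with STRICT gap inequality).
  It contains the coherent window law (no opposite signs), binomial poles on both sides, «knee window + one pole ≥ p above it», switched clouds whose
  tail spans `≤ p`; numerics first (`lab/pair_law.py`: 0 / 325 690 violations, half of them on the switched side).

Honest framing: calculus of rows (helpers); nothing closes a stub; `OneChangeFloorK3` / `WronskianBudgetK3` / 18050 / `MatrixDescartes` OPEN; `VP ≠ VNP` NOT proved.
No definitions, no named facts.
-/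

set_option linter.dupNamespace false

namespace Summit.ValiantsHypothesis.ValiantsHypothesis.Theorems.LacunarySymmetroidMatrixDescartes

namespace ProductPlusOne

open Finset
open scoped BigOperators

/-! ### §1 The pair certificate -/

/-- The pair double sum through the moments (any finite family of weights `W` and points `R`):
`Σ_a Σ_b W_a W_b (R_a − R_b)²(p² − (R_a − R_b)²) = 2p²·M₀M₂ − 2·M₀M₄ − 2p²·M₁² + 8·M₁M₃ − 6·M₂²`, `M_k = Σ_a W_a R_a^k` (written symmetrically so that the summands match).  [this file's lemma] -/
theorem pairDoubleSum_eq {ι : Type*} [Fintype ι] (W R : ι → ℝ) (p : ℝ) :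
    ∑ a, ∑ b, W a * W b * ((R a - R b) ^ 2 * (p ^ 2 - (R a - R b) ^ 2))
      = p ^ 2 * ((∑ a, W a * R a ^ 2) * (∑ a, W a * R a ^ 0)) - 2 * p ^ 2 * ((∑ a, W a * R a ^ 1) * (∑ a, W a * R a ^ 1))
        + p ^ 2 * ((∑ a, W a * R a ^ 0) * (∑ a, W a * R a ^ 2))
        - (∑ a, W a * R a ^ 4) * (∑ a, W a * R a ^ 0) + 4 * ((∑ a, W a * R a ^ 3) * (∑ a, W a * R a ^ 1))
        - 6 * ((∑ a, W a * R a ^ 2) * (∑ a, W a * R a ^ 2)) + 4 * ((∑ a, W a * R a ^ 1) * (∑ a, W a * R a ^ 3))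
        - (∑ a, W a * R a ^ 0) * (∑ a, W a * R a ^ 4) := by
  simp only [Finset.sum_mul_sum]
  simp only [Finset.mul_sum, ← Finset.sum_sub_distrib, ← Finset.sum_add_distrib]
  exact Finset.sum_congr rfl fun a _ => Finset.sum_congr rfl fun b _ => by ring

variable {n : ℕ} (lam : Fin n → ℕ) (A : ℝ) (B : Fin n → ℝ)

/-- Moments in the `W·R^k` order: `Σ_l w_l λ_l^k = −H_k u`. [this file's lemma] -/
theorem rateWeights_moment' (k : ℕ) (x : ℝ) :
    ∑ l, (-(B l * x ^ (lam l))) * rowUK lam A B x * ((lam l : ℕ) : ℝ) ^ k = -(rowHK lam k B x * rowUK lam A B x) := by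
  rw [← rateWeights_moment lam A B k x]
  exact Finset.sum_congr rfl fun l _ => by ring

/-- ★ **THE PAIR CERTIFICATE** (pure identity, any signs, any real `p`, wherever the row does not vanish):
`ψ₃ − p²ψ₁ − 6ψ₁² = ½ Σ_l Σ_{l'} w_l w_{l'} (λ_l − λ_{l'})²(p² − (λ_l − λ_{l'})²) + A u · Σ_l w_l λ_l²(p² − λ_l²)`. [this file's theorem] -/
theorem rowPsiK3_pair_certificate (p : ℝ) {x : ℝ} (hF : A - ∑ l, B l * x ^ (lam l) ≠ 0) :
    rowPsiK3 lam A B x - p ^ 2 * rowPsiK1 lam A B x - 6 * rowPsiK1 lam A B x ^ 2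
      = (1 / 2) * ∑ l, ∑ l', (-(B l * x ^ (lam l))) * rowUK lam A B x * ((-(B l' * x ^ (lam l'))) * rowUK lam A B x)
            * ((((lam l : ℕ) : ℝ) - ((lam l' : ℕ) : ℝ)) ^ 2 * (p ^ 2 - (((lam l : ℕ) : ℝ) - ((lam l' : ℕ) : ℝ)) ^ 2))
        + A * rowUK lam A B x
            * ∑ l, (-(B l * x ^ (lam l))) * rowUK lam A B x * (((lam l : ℕ) : ℝ) ^ 2 * (p ^ 2 - ((lam l : ℕ) : ℝ) ^ 2)) := by
  rw [pairDoubleSum_eq (fun l => (-(B l * x ^ (lam l))) * rowUK lam A B x) (fun l => ((lam l : ℕ) : ℝ)) p]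
  have hsingle : ∑ l, (-(B l * x ^ (lam l))) * rowUK lam A B x * (((lam l : ℕ) : ℝ) ^ 2 * (p ^ 2 - ((lam l : ℕ) : ℝ) ^ 2))
      = p ^ 2 * ∑ l, (-(B l * x ^ (lam l))) * rowUK lam A B x * ((lam l : ℕ) : ℝ) ^ 2
        - ∑ l, (-(B l * x ^ (lam l))) * rowUK lam A B x * ((lam l : ℕ) : ℝ) ^ 4 := by
    rw [Finset.mul_sum, ← Finset.sum_sub_distrib]
    exact Finset.sum_congr rfl fun l _ => by ring
  rw [hsingle, rateWeights_moment' lam A B 0 x, rateWeights_moment' lam A B 1 x, rateWeights_moment' lam A B 2 x,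
    rateWeights_moment' lam A B 3 x, rateWeights_moment' lam A B 4 x, neg_rowHK_zero_mul_rowUK lam A B hF]
  unfold rowPsiK3 rowPsiK1
  ring

/-! ### §2 The pair-gap law -/

/-- One term of the pair double sum is non-negative under the pair-gap rule (tail–tail pair). [this file's lemma] -/
theorem pairTerm_nonneg (p : ℕ) {x : ℝ} (hx : 0 < x) (l l' : Fin n)
    (hsame : 0 < B l * B l' → lam l ≤ lam l' + p ∧ lam l' ≤ lam l + p)
    (hopp : B l * B l' < 0 → lam l + p ≤ lam l' ∨ lam l' + p ≤ lam l) :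
    0 ≤ (-(B l * x ^ (lam l))) * rowUK lam A B x * ((-(B l' * x ^ (lam l'))) * rowUK lam A B x)
        * ((((lam l : ℕ) : ℝ) - ((lam l' : ℕ) : ℝ)) ^ 2 * ((p : ℝ) ^ 2 - (((lam l : ℕ) : ℝ) - ((lam l' : ℕ) : ℝ)) ^ 2)) := by
  have hfac : (-(B l * x ^ (lam l))) * rowUK lam A B x * ((-(B l' * x ^ (lam l'))) * rowUK lam A B x)
      = (B l * B l') * (x ^ (lam l) * x ^ (lam l') * rowUK lam A B x ^ 2) := by ring
  rw [hfac]
  have hpos : 0 ≤ x ^ (lam l) * x ^ (lam l') * rowUK lam A B x ^ 2 := by positivity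
  have hp0 : (0 : ℝ) ≤ (p : ℝ) := Nat.cast_nonneg p
  rcases lt_trichotomy (B l * B l') 0 with hneg | h0 | hposB
  · -- opposite signs: gap `≥ p`, so `p² − gap² ≤ 0` and the weight product is `≤ 0`
    have hgap : (p : ℝ) ^ 2 ≤ (((lam l : ℕ) : ℝ) - ((lam l' : ℕ) : ℝ)) ^ 2 := by
      rcases hopp hneg with h | h
      · have h' : ((lam l : ℕ) : ℝ) + p ≤ ((lam l' : ℕ) : ℝ) := by exact_mod_cast h
        nlinarith
      · have h' : ((lam l' : ℕ) : ℝ) + p ≤ ((lam l : ℕ) : ℝ) := by exact_mod_cast h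
        nlinarith
    have h1 : B l * B l' * (x ^ (lam l) * x ^ (lam l') * rowUK lam A B x ^ 2) ≤ 0 := mul_nonpos_of_nonpos_of_nonneg hneg.le hpos
    have h2 : (((lam l : ℕ) : ℝ) - ((lam l' : ℕ) : ℝ)) ^ 2 * ((p : ℝ) ^ 2 - (((lam l : ℕ) : ℝ) - ((lam l' : ℕ) : ℝ)) ^ 2) ≤ 0 :=
      mul_nonpos_of_nonneg_of_nonpos (sq_nonneg _) (by linarith)
    exact mul_nonneg_of_nonpos_of_nonpos h1 h2
  · rw [h0]; simp
  · -- same sign: gap `≤ p`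
    have hgap : (((lam l : ℕ) : ℝ) - ((lam l' : ℕ) : ℝ)) ^ 2 ≤ (p : ℝ) ^ 2 := by
      obtain ⟨h1, h2⟩ := hsame hposB
      have h1' : ((lam l : ℕ) : ℝ) ≤ ((lam l' : ℕ) : ℝ) + p := by exact_mod_cast h1
      have h2' : ((lam l' : ℕ) : ℝ) ≤ ((lam l : ℕ) : ℝ) + p := by exact_mod_cast h2
      exact sq_le_sq' (by linarith) (by linarith)
    have h1 : 0 ≤ B l * B l' * (x ^ (lam l) * x ^ (lam l') * rowUK lam A B x ^ 2) := mul_nonneg hposB.le hpos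
    have h2 : 0 ≤ (((lam l : ℕ) : ℝ) - ((lam l' : ℕ) : ℝ)) ^ 2 * ((p : ℝ) ^ 2 - (((lam l : ℕ) : ℝ) - ((lam l' : ℕ) : ℝ)) ^ 2) :=
      mul_nonneg (sq_nonneg _) (by linarith)
    exact mul_nonneg h1 h2

/-- One bottom–tail term is non-negative under the pair-gap rule (`A·B_l < 0` = same sign ⇒ `λ_l ≤ p`; `A·B_l > 0` = opposite ⇒ `λ_l ≥ p`). [this file's lemma] -/
theorem bottomTerm_nonneg (p : ℕ) {x : ℝ} (hx : 0 < x) (l : Fin n)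
    (hsame : A * B l < 0 → lam l ≤ p) (hopp : 0 < A * B l → p ≤ lam l) :
    0 ≤ A * rowUK lam A B x * ((-(B l * x ^ (lam l))) * rowUK lam A B x * (((lam l : ℕ) : ℝ) ^ 2 * ((p : ℝ) ^ 2 - ((lam l : ℕ) : ℝ) ^ 2))) := by
  have hfac : A * rowUK lam A B x * ((-(B l * x ^ (lam l))) * rowUK lam A B x * (((lam l : ℕ) : ℝ) ^ 2 * ((p : ℝ) ^ 2 - ((lam l : ℕ) : ℝ) ^ 2)))
      = -(A * B l) * (x ^ (lam l) * rowUK lam A B x ^ 2) * (((lam l : ℕ) : ℝ) ^ 2 * ((p : ℝ) ^ 2 - ((lam l : ℕ) : ℝ) ^ 2)) := by ring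
  rw [hfac]
  have hpos : 0 ≤ x ^ (lam l) * rowUK lam A B x ^ 2 := by positivity
  have hp0 : (0 : ℝ) ≤ (p : ℝ) := Nat.cast_nonneg p
  have hl0 : (0 : ℝ) ≤ ((lam l : ℕ) : ℝ) := Nat.cast_nonneg _
  rcases lt_trichotomy (A * B l) 0 with hneg | h0 | hposB
  · have h' : ((lam l : ℕ) : ℝ) ≤ (p : ℝ) := by exact_mod_cast hsame hneg
    have h2 : 0 ≤ ((lam l : ℕ) : ℝ) ^ 2 * ((p : ℝ) ^ 2 - ((lam l : ℕ) : ℝ) ^ 2) := mul_nonneg (sq_nonneg _) (by nlinarith)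
    exact mul_nonneg (mul_nonneg (by linarith) hpos) h2
  · rw [h0]; simp
  · have h' : (p : ℝ) ≤ ((lam l : ℕ) : ℝ) := by exact_mod_cast hopp hposB
    have h2 : ((lam l : ℕ) : ℝ) ^ 2 * ((p : ℝ) ^ 2 - ((lam l : ℕ) : ℝ) ^ 2) ≤ 0 := mul_nonpos_of_nonneg_of_nonpos (sq_nonneg _) (by nlinarith)
    exact mul_nonneg_of_nonpos_of_nonpos (mul_nonpos_of_nonpos_of_nonneg (by linarith) hpos) h2

/-- ★ **THE PAIR-GAP LAW for every K, both sides of the root**: if every two tail letters with `B_l B_{l'} > 0` are at gap `≤ p`, every two with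
`B_l B_{l'} < 0` at gap `≥ p`, every tail letter with `A·B_l < 0` has `λ_l ≤ p` and every one with `A·B_l > 0` has `λ_l ≥ p` (`x > 0`, row non-vanishing),
then `p²ψ₁ + 6ψ₁² ≤ ψ₃`. [this file's theorem] -/
theorem rowPsiK3_pairGap_law (p : ℕ) {x : ℝ} (hx : 0 < x) (hF : A - ∑ l, B l * x ^ (lam l) ≠ 0)
    (hsame : ∀ l l', 0 < B l * B l' → lam l ≤ lam l' + p ∧ lam l' ≤ lam l + p)
    (hopp : ∀ l l', B l * B l' < 0 → lam l + p ≤ lam l' ∨ lam l' + p ≤ lam l)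
    (hsame0 : ∀ l, A * B l < 0 → lam l ≤ p) (hopp0 : ∀ l, 0 < A * B l → p ≤ lam l) :
    (p : ℝ) ^ 2 * rowPsiK1 lam A B x + 6 * rowPsiK1 lam A B x ^ 2 ≤ rowPsiK3 lam A B x := by
  have hcert := rowPsiK3_pair_certificate lam A B (p : ℝ) hF
  have hS : 0 ≤ ∑ l, ∑ l', (-(B l * x ^ (lam l))) * rowUK lam A B x * ((-(B l' * x ^ (lam l'))) * rowUK lam A B x)
      * ((((lam l : ℕ) : ℝ) - ((lam l' : ℕ) : ℝ)) ^ 2 * ((p : ℝ) ^ 2 - (((lam l : ℕ) : ℝ) - ((lam l' : ℕ) : ℝ)) ^ 2)) :=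
    Finset.sum_nonneg fun l _ => Finset.sum_nonneg fun l' _ => pairTerm_nonneg lam A B p hx l l' (hsame l l') (hopp l l')
  have hT : 0 ≤ A * rowUK lam A B x
      * ∑ l, (-(B l * x ^ (lam l))) * rowUK lam A B x * (((lam l : ℕ) : ℝ) ^ 2 * ((p : ℝ) ^ 2 - ((lam l : ℕ) : ℝ) ^ 2)) := by
    rw [Finset.mul_sum]
    exact Finset.sum_nonneg fun l _ => bottomTerm_nonneg lam A B p hx l (hsame0 l) (hopp0 l)
  nlinarith

/-- ★ (pair-gap law, strict form) `ψ₁ ≠ 0 ⇒ p²ψ₁ < ψ₃`. [this file's theorem] -/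
theorem rowPsiK3_gt_of_pairGap (p : ℕ) {x : ℝ} (hx : 0 < x) (hF : A - ∑ l, B l * x ^ (lam l) ≠ 0)
    (hsame : ∀ l l', 0 < B l * B l' → lam l ≤ lam l' + p ∧ lam l' ≤ lam l + p)
    (hopp : ∀ l l', B l * B l' < 0 → lam l + p ≤ lam l' ∨ lam l' + p ≤ lam l)
    (hsame0 : ∀ l, A * B l < 0 → lam l ≤ p) (hopp0 : ∀ l, 0 < A * B l → p ≤ lam l) (hψ : rowPsiK1 lam A B x ≠ 0) :
    (p : ℝ) ^ 2 * rowPsiK1 lam A B x < rowPsiK3 lam A B x := by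
  have h := rowPsiK3_pairGap_law lam A B p hx hF hsame hopp hsame0 hopp0
  have : 0 < rowPsiK1 lam A B x ^ 2 := by positivity
  linarith

/-- ★ (pair-gap law, strict form from a STRICT pair) if moreover one tail pair of active letters has `B_l B_{l'} > 0` with gap `< p`, or `B_l B_{l'} < 0` with
gap `> p`, or one tail letter has `A·B_l < 0` with `0 < λ_l < p`, or `A·B_l > 0` with `λ_l > p`, then `p²ψ₁ < ψ₃`. [this file's theorem] -/
theorem rowPsiK3_gt_of_pairGap_of_pair (p : ℕ) {x : ℝ} (hx : 0 < x) (hF : A - ∑ l, B l * x ^ (lam l) ≠ 0)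
    (hsame : ∀ l l', 0 < B l * B l' → lam l ≤ lam l' + p ∧ lam l' ≤ lam l + p)
    (hopp : ∀ l l', B l * B l' < 0 → lam l + p ≤ lam l' ∨ lam l' + p ≤ lam l)
    (hsame0 : ∀ l, A * B l < 0 → lam l ≤ p) (hopp0 : ∀ l, 0 < A * B l → p ≤ lam l)
    (hstrict : (∃ l l', (0 < B l * B l' ∧ lam l < lam l' ∧ lam l' < lam l + p) ∨ (B l * B l' < 0 ∧ lam l + p < lam l')) ∨
      (∃ l, (A * B l < 0 ∧ 0 < lam l ∧ lam l < p) ∨ (0 < A * B l ∧ p < lam l))) :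
    (p : ℝ) ^ 2 * rowPsiK1 lam A B x < rowPsiK3 lam A B x := by
  have hcert := rowPsiK3_pair_certificate lam A B (p : ℝ) hF
  have hu : rowUK lam A B x ≠ 0 := by unfold rowUK; exact inv_ne_zero hF
  have hu2 : 0 < rowUK lam A B x ^ 2 := by positivity
  have hp0 : (0 : ℝ) ≤ (p : ℝ) := Nat.cast_nonneg p
  have hterm := fun l l' => pairTerm_nonneg lam A B p hx l l' (hsame l l') (hopp l l')
  have hbot := fun l => bottomTerm_nonneg lam A B p hx l (hsame0 l) (hopp0 l)
  have hS : 0 ≤ ∑ l, ∑ l', (-(B l * x ^ (lam l))) * rowUK lam A B x * ((-(B l' * x ^ (lam l'))) * rowUK lam A B x)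
      * ((((lam l : ℕ) : ℝ) - ((lam l' : ℕ) : ℝ)) ^ 2 * ((p : ℝ) ^ 2 - (((lam l : ℕ) : ℝ) - ((lam l' : ℕ) : ℝ)) ^ 2)) :=
    Finset.sum_nonneg fun l _ => Finset.sum_nonneg fun l' _ => hterm l l'
  have hTsum : A * rowUK lam A B x
      * ∑ l, (-(B l * x ^ (lam l))) * rowUK lam A B x * (((lam l : ℕ) : ℝ) ^ 2 * ((p : ℝ) ^ 2 - ((lam l : ℕ) : ℝ) ^ 2))
      = ∑ l, A * rowUK lam A B x
          * ((-(B l * x ^ (lam l))) * rowUK lam A B x * (((lam l : ℕ) : ℝ) ^ 2 * ((p : ℝ) ^ 2 - ((lam l : ℕ) : ℝ) ^ 2))) :=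
    Finset.mul_sum _ _ _
  have hT : 0 ≤ ∑ l, A * rowUK lam A B x
      * ((-(B l * x ^ (lam l))) * rowUK lam A B x * (((lam l : ℕ) : ℝ) ^ 2 * ((p : ℝ) ^ 2 - ((lam l : ℕ) : ℝ) ^ 2))) :=
    Finset.sum_nonneg fun l _ => hbot l
  rw [hTsum] at hcert
  have hsq : 0 ≤ rowPsiK1 lam A B x ^ 2 := sq_nonneg _
  -- a strictly positive term
  rcases hstrict with ⟨l, l', hll'⟩ | ⟨l, hl⟩
  · have hpos : 0 < (-(B l * x ^ (lam l))) * rowUK lam A B x * ((-(B l' * x ^ (lam l'))) * rowUK lam A B x)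
        * ((((lam l : ℕ) : ℝ) - ((lam l' : ℕ) : ℝ)) ^ 2 * ((p : ℝ) ^ 2 - (((lam l : ℕ) : ℝ) - ((lam l' : ℕ) : ℝ)) ^ 2)) := by
      have hfac : (-(B l * x ^ (lam l))) * rowUK lam A B x * ((-(B l' * x ^ (lam l'))) * rowUK lam A B x)
          = (B l * B l') * (x ^ (lam l) * x ^ (lam l') * rowUK lam A B x ^ 2) := by ring
      rw [hfac]
      have hxx : 0 < x ^ (lam l) * x ^ (lam l') * rowUK lam A B x ^ 2 := by positivity
      rcases hll' with ⟨hBB, h1, h2⟩ | ⟨hBB, h1⟩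
      · have h1' : ((lam l : ℕ) : ℝ) < ((lam l' : ℕ) : ℝ) := by exact_mod_cast h1
        have h2' : ((lam l' : ℕ) : ℝ) < ((lam l : ℕ) : ℝ) + p := by exact_mod_cast h2
        have hg1 : 0 < (((lam l : ℕ) : ℝ) - ((lam l' : ℕ) : ℝ)) ^ 2 := by
          have : ((lam l : ℕ) : ℝ) - ((lam l' : ℕ) : ℝ) ≠ 0 := by linarith
          positivity
        have hg2 : 0 < (p : ℝ) ^ 2 - (((lam l : ℕ) : ℝ) - ((lam l' : ℕ) : ℝ)) ^ 2 := by nlinarith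
        exact mul_pos (mul_pos hBB hxx) (mul_pos hg1 hg2)
      · have h1' : ((lam l : ℕ) : ℝ) + p < ((lam l' : ℕ) : ℝ) := by exact_mod_cast h1
        have hg2 : (p : ℝ) ^ 2 - (((lam l : ℕ) : ℝ) - ((lam l' : ℕ) : ℝ)) ^ 2 < 0 := by nlinarith
        have hg1 : 0 < (((lam l : ℕ) : ℝ) - ((lam l' : ℕ) : ℝ)) ^ 2 := by
          have : ((lam l : ℕ) : ℝ) - ((lam l' : ℕ) : ℝ) ≠ 0 := by linarith
          positivity
        have := mul_pos_of_neg_of_neg (mul_neg_of_neg_of_pos hBB hxx) (mul_neg_of_pos_of_neg hg1 hg2)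
        linarith
    have hge : (-(B l * x ^ (lam l))) * rowUK lam A B x * ((-(B l' * x ^ (lam l'))) * rowUK lam A B x)
        * ((((lam l : ℕ) : ℝ) - ((lam l' : ℕ) : ℝ)) ^ 2 * ((p : ℝ) ^ 2 - (((lam l : ℕ) : ℝ) - ((lam l' : ℕ) : ℝ)) ^ 2))
        ≤ ∑ a, ∑ b, (-(B a * x ^ (lam a))) * rowUK lam A B x * ((-(B b * x ^ (lam b))) * rowUK lam A B x)
          * ((((lam a : ℕ) : ℝ) - ((lam b : ℕ) : ℝ)) ^ 2 * ((p : ℝ) ^ 2 - (((lam a : ℕ) : ℝ) - ((lam b : ℕ) : ℝ)) ^ 2)) := by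
      refine le_trans ?_ (Finset.single_le_sum (fun a _ => Finset.sum_nonneg fun b _ => hterm a b) (Finset.mem_univ l))
      exact Finset.single_le_sum (fun b _ => hterm l b) (Finset.mem_univ l')
    linarith
  · have hpos : 0 < A * rowUK lam A B x
        * ((-(B l * x ^ (lam l))) * rowUK lam A B x * (((lam l : ℕ) : ℝ) ^ 2 * ((p : ℝ) ^ 2 - ((lam l : ℕ) : ℝ) ^ 2))) := by
      have hfac : A * rowUK lam A B x * ((-(B l * x ^ (lam l))) * rowUK lam A B x * (((lam l : ℕ) : ℝ) ^ 2 * ((p : ℝ) ^ 2 - ((lam l : ℕ) : ℝ) ^ 2)))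
          = -(A * B l) * (x ^ (lam l) * rowUK lam A B x ^ 2) * (((lam l : ℕ) : ℝ) ^ 2 * ((p : ℝ) ^ 2 - ((lam l : ℕ) : ℝ) ^ 2)) := by ring
      rw [hfac]
      have hxx : 0 < x ^ (lam l) * rowUK lam A B x ^ 2 := by positivity
      have hl0 : (0 : ℝ) ≤ ((lam l : ℕ) : ℝ) := Nat.cast_nonneg _
      rcases hl with ⟨hAB, h0, h1⟩ | ⟨hAB, h1⟩
      · have h1' : ((lam l : ℕ) : ℝ) < (p : ℝ) := by exact_mod_cast h1
        have hl1 : (0 : ℝ) < ((lam l : ℕ) : ℝ) := by exact_mod_cast h0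
        have hg : 0 < ((lam l : ℕ) : ℝ) ^ 2 * ((p : ℝ) ^ 2 - ((lam l : ℕ) : ℝ) ^ 2) := mul_pos (by positivity) (by nlinarith)
        exact mul_pos (mul_pos (by linarith) hxx) hg
      · have h1' : (p : ℝ) < ((lam l : ℕ) : ℝ) := by exact_mod_cast h1
        have hl1 : (0 : ℝ) < ((lam l : ℕ) : ℝ) := lt_of_le_of_lt hp0 h1'
        have hg : ((lam l : ℕ) : ℝ) ^ 2 * ((p : ℝ) ^ 2 - ((lam l : ℕ) : ℝ) ^ 2) < 0 := mul_neg_of_pos_of_neg (by positivity) (by nlinarith)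
        have := mul_pos_of_neg_of_neg (mul_neg_of_neg_of_pos (by linarith : -(A * B l) < 0) hxx) hg
        linarith
    have hge : A * rowUK lam A B x
        * ((-(B l * x ^ (lam l))) * rowUK lam A B x * (((lam l : ℕ) : ℝ) ^ 2 * ((p : ℝ) ^ 2 - ((lam l : ℕ) : ℝ) ^ 2)))
        ≤ ∑ a, A * rowUK lam A B x
          * ((-(B a * x ^ (lam a))) * rowUK lam A B x * (((lam a : ℕ) : ℝ) ^ 2 * ((p : ℝ) ^ 2 - ((lam a : ℕ) : ℝ) ^ 2))) :=
      Finset.single_le_sum (fun a _ => hbot a) (Finset.mem_univ l)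
    linarith

end ProductPlusOne

end Summit.ValiantsHypothesis.ValiantsHypothesis.Theorems.LacunarySymmetroidMatrixDescartes
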